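import Literature.MathematicalPhysics.QuantumLattice.YangMillsClassical
import Mathlib.Analysis.Calculus.FDeriv.Symmetric
import Mathlib.Tactic.NoncommRing
import HarnessLib

/-!
# Discharge of the Bianchi identity (`YangMillsClassical`)

Trunk `QLatticeAQFT`, item G13 (`ym_classical_connection`).  Sibling proof file of
`Literature/MathematicalPhysics/QuantumLattice/YangMillsClassical.lean`: it discharges the named
fact (`def X : Prop`, D-0014) `Literature.MathematicalPhysics.QuantumLattice.covDeriv_curvature_cyclic` of that file as
`theorem Literature.AQFT.covDeriv_curvature_cyclic_holds : covDeriv_curvature_cyclic`, from Mathlib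
only.  No statement is introduced or changed here.

Discharged:

* `Literature.AQFT.covDeriv_curvature_cyclic_holds : covDeriv_curvature_cyclic` — the Bianchi identity
  `D_A F_A = 0` for a `C²` connection `A : E → (E →L[ℝ] 𝔸)` on flat space (trivial bundle),
  evaluated on constant vectors: `D_u F(v,w) + D_v F(w,u) + D_w F(u,v) = 0`, where
  `F(v,w) = ∂_v A_w − ∂_w A_v + [A_v, A_w]` (`Literature.MathematicalPhysics.QuantumLattice.curvature`) and
  `D_u φ = ∂_u φ + [A_u, φ]` (`Literature.MathematicalPhysics.QuantumLattice.covDeriv`).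

Auxiliary: `Literature.MathematicalPhysics.QuantumLattice.hasFDerivAt_clm_apply_const` — evaluation at a fixed vector commutes with
differentiation (`HasFDerivAt.clm_apply` with a constant second argument).

## Proof

This is the flat-space component computation of the physics literature.  With the conventions
`F_{μν} = ∂_μ A_ν − ∂_ν A_μ + [A_μ, A_ν]` and `D_μ Φ = ∂_μ Φ + [A_μ, Φ]` (which are exactly those
of `curvature` / `covDeriv`), Yang (2023) states the Bianchi identity
`D_α F_{βγ} + D_β F_{γα} + D_γ F_{αβ} = 0` as (9.1.29) and derives it from the Jacobi identity
for the covariant derivatives (9.1.27) together with the Jacobi identity in the Lie algebra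
(9.1.28).  Unfolded, this is the following bookkeeping, which is what we formalise: writing
`A' = DA` and `A'' = D²A` (Fréchet derivatives of `A : E → (E →L[ℝ] 𝔸)`),

* `∂_u F(v,w) = A''(u,v) w − A''(u,w) v + [A'(u) v, A_w] + [A_v, A'(u) w]` (product rule for the
  commutator, `HasFDerivAt.mul'`), and `[A_u, F(v,w)] = [A_u, A'(v) w − A'(w) v] + [A_u,[A_v,A_w]]`;
* in the cyclic sum the six second-derivative terms cancel in pairs by the symmetry
  `A''(u,v) = A''(v,u)` of second derivatives of `C²` maps over `ℝ`
  (`second_derivative_symmetric`);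
* the twelve first-order commutator terms cancel in pairs identically, and the three triple
  commutators cancel by the Jacobi identity of the commutator bracket in the associative
  algebra `𝔸`; both are a polynomial identity in non-commuting variables (`noncomm_ring`).

The `C²` hypothesis of the fact is used twice: differentiability of `A` and of `DA` (so that all
`fderiv`s are genuine derivatives, no junk values) and symmetry of `D²A`.

## Sources

* Y. Yang, *Mathematical Physics with Differential Equations*, Oxford University Press (2023),
  doi:10.1093/oso/9780192872616.001.0001 (held; read pp. 157–159): §9.1, **(9.1.12)**
  `F_{μν} = ∂_μA_ν − ∂_νA_μ + [A_μ, A_ν]`, **(9.1.20)** `D_μA = ∂_μA + [A_μ, A]`, **(9.1.29)**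
  "the Bianchi identity `D_αF_{βγ} + D_βF_{γα} + D_γF_{αβ} = 0`", obtained from the Jacobi
  identities **(9.1.27)**–**(9.1.28)**.
* A. Jaffe, E. Witten, *Quantum Yang–Mills theory*, Clay Mathematics Institute Millennium
  Problem description (2000), §1 (`F = dA + A ∧ A`, Bianchi identity `d_A F = 0`) — the key
  under which the fact is vendored; not held in the literature store at the time of writing
  (acquisition requests acq-00103/acq-00119), so the printed equation numbers above are Yang's.
* S. K. Donaldson, P. B. Kronheimer, *The Geometry of Four-Manifolds* (OUP 1990), §2.1,
  (2.1.21) `d_A F_A = 0` (locator of the fact's docstring).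
-/

noncomputable section

open scoped ContDiff

namespace Literature.MathematicalPhysics.QuantumLattice

section Bianchi

variable {E : Type*} [NormedAddCommGroup E] [InnerProductSpace ℝ E]
variable {𝔸 : Type*} [NormedRing 𝔸] [NormedAlgebra ℝ 𝔸]

/-- Evaluation at a fixed vector commutes with differentiation: if `c : E → (F →L[ℝ] G)` has
Fréchet derivative `c'` at `y`, then `z ↦ c z b` has derivative `c'.flip b = (u ↦ c' u b)` at `y`.
Special case (`u` constant) of Mathlib's `HasFDerivAt.clm_apply`. [folklore] -/
theorem hasFDerivAt_clm_apply_const {F G : Type*} [NormedAddCommGroup F] [NormedSpace ℝ F]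
    [NormedAddCommGroup G] [NormedSpace ℝ G] {c : E → F →L[ℝ] G} {c' : E →L[ℝ] F →L[ℝ] G}
    {y : E} (h : HasFDerivAt c c' y) (b : F) :
    HasFDerivAt (fun z => c z b) (c'.flip b) y := by
  simpa using h.clm_apply (hasFDerivAt_const b y)

/-- **Discharge of `covDeriv_curvature_cyclic` (Bianchi identity `D_A F_A = 0` on flat space).**
For a `C²` connection `A` and constant vectors `u v w`,
`D_u F(v,w) + D_v F(w,u) + D_w F(u,v) = 0`.  Proof: expand `∂_u F(v,w)` by the product rule for
the commutator and `[A_u, F(v,w)]` by bilinearity; in the cyclic sum the second derivatives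
`D²A(u,v) w` cancel pairwise by symmetry of second derivatives of `C²` maps over `ℝ`, the
first-order commutators cancel pairwise, and the triple commutators cancel by the Jacobi
identity — the component form of Yang (2023) (9.1.27)–(9.1.29), with `F` as in (9.1.12) and `D`
as in (9.1.20); Jaffe–Witten (2000) §1; Donaldson–Kronheimer (2.1.21).
[cite: JaffeWitten2000, §1] [cite: Yang2023, §9.1 (9.1.29)] -/
theorem covDeriv_curvature_cyclic_holds : covDeriv_curvature_cyclic (E := E) (𝔸 := 𝔸) := by
  intro A hA x u v w
  -- first and second Fréchet derivatives of `A`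
  set A' : E → E →L[ℝ] E →L[ℝ] 𝔸 := fderiv ℝ A
  set A'' : E → E →L[ℝ] E →L[ℝ] E →L[ℝ] 𝔸 := fderiv ℝ (fderiv ℝ A)
  have hd : ∀ y, HasFDerivAt A (A' y) y := fun y =>
    (hA.differentiable two_ne_zero y).hasFDerivAt
  have hd' : ∀ y, HasFDerivAt A' (A'' y) y := fun y =>
    ((hA.fderiv_right (m := 1) le_rfl).differentiable one_ne_zero y).hasFDerivAt
  -- symmetry of second derivatives (`C²` over `ℝ`)
  have hsymm : ∀ a b, A'' x a b = A'' x b a := fun a b =>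
    second_derivative_symmetric hd (hd' x) a b
  -- the components `z ↦ A z b` and their derivatives, at every point
  have hc : ∀ y b, HasFDerivAt (fun z => A z b) ((A' y).flip b) y := fun y b =>
    hasFDerivAt_clm_apply_const (hd y) b
  have h1 : ∀ a b, (fun y => fderiv ℝ (fun z => A z b) y a) = fun y => A' y a b := by
    intro a b
    funext y
    rw [(hc y b).fderiv, ContinuousLinearMap.flip_apply]
  -- the curvature as a function of the base point: `F(a,b) = A'(a) b - A'(b) a + [A_a, A_b]`
  have hF : ∀ a b, (fun y => curvature A y a b) =
      fun y => A' y a b - A' y b a + (A y a * A y b - A y b * A y a) := by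
    intro a b
    funext y
    simp only [curvature, Ring.lie_def]
    rw [show fderiv ℝ (fun z => A z b) y a = A' y a b from congrFun (h1 a b) y,
      show fderiv ℝ (fun z => A z a) y b = A' y b a from congrFun (h1 b a) y]
  -- derivative of the second-order components `y ↦ A'(y)(a) b`
  have h2 : ∀ a b, HasFDerivAt (fun y => A' y a b) (((A'' x).flip a).flip b) x := fun a b =>
    hasFDerivAt_clm_apply_const (hasFDerivAt_clm_apply_const (hd' x) a) b
  -- `∂_c F(a,b) = A''(c,a) b - A''(c,b) a + [A_a, A'(c) b] + [A'(c) a, A_b]` (product rule)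
  have hF' : ∀ a b c, fderiv ℝ (fun y => curvature A y a b) x c =
      A'' x c a b - A'' x c b a +
        (A x a * A' x c b + A' x c a * A x b - (A x b * A' x c a + A' x c b * A x a)) := by
    intro a b c
    rw [hF, (((h2 a b).fun_sub (h2 b a)).fun_add
      (((hc x a).fun_mul' (hc x b)).fun_sub ((hc x b).fun_mul' (hc x a)))).fderiv]
    simp only [add_apply, sub_apply, ContinuousLinearMap.flip_apply, smul_apply, smul_eq_mul,
      op_smul_eq_mul]
  -- expand the three covariant derivatives and the remaining curvatures
  simp only [covDeriv, hF']
  simp only [curvature, Ring.lie_def]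
  rw [show fderiv ℝ (fun z => A z w) x v = A' x v w from congrFun (h1 v w) x,
    show fderiv ℝ (fun z => A z v) x w = A' x w v from congrFun (h1 w v) x,
    show fderiv ℝ (fun z => A z u) x w = A' x w u from congrFun (h1 w u) x,
    show fderiv ℝ (fun z => A z w) x u = A' x u w from congrFun (h1 u w) x,
    show fderiv ℝ (fun z => A z v) x u = A' x u v from congrFun (h1 u v) x,
    show fderiv ℝ (fun z => A z u) x v = A' x v u from congrFun (h1 v u) x]
  -- second derivatives cancel by symmetry; the rest is Jacobi + pairwise cancellation
  rw [hsymm v u, hsymm w v, hsymm u w]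
  noncomm_ring

end Bianchi

end Literature.MathematicalPhysics.QuantumLattice

end
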